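import Summits.NavierStokesRegularity.NavierStokesRegularity.Theorems.AxisymmetricExtremalityAxisymmetricKatoGlobalStubSeregin2020TypeIILemma22ExcisionError
import Literature.Analysis.FluidPDE.SmoothParabolicHolder
import HarnessLib

/-!
# Seregin 2020, Lemma 2.2 (after Nazarov–Uraltseva 2012): the very weak inequality with the
# axis term for test functions NOT avoiding the singular set `S` (excision of a `𝒫¹`-null set)

Helper toward the stub `stub_seregin2020TypeII` of the crux `AxisymmetricKatoGlobal` (= the named
fact `Literature.Analysis.FluidPDE.Seregin2020_axisymmetricSingularPoint_typeII`, G. Seregin,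
Anal. Math. Phys. 10 (2020) Paper 46 = arXiv:2006.04140, Thm 2.1), reduced in the tree to the
corrected Lemma 2.2 (`hWH′`; Nazarov–Uraltseva 2012, Lemma 4.2 for the class 𝒱). The landed
very weak form `veryWeak_supersolution_axis_lowerBound` (N–U (4.5)) needs test functions
supported in the regular set `{t < 0} ∖ S` (Seregin 2020, class 𝒱 (i): `S` closed, on the axis,
`𝒫¹`-null); N–U's (4.6) tests with a plain cut-off of a cylinder, meeting `S`. This file removes
the restriction ("the above inequality is still true for functions `π` from the class 𝒱"):
`veryWeak_supersolution_axis_acrossS` — `4πk ∫∫ η₀|axis ≤ ∫∫ Φ (|∂ₜη₀| + ‖U‖‖Dη₀‖ + (2/ϱ)‖Dη₀‖ + |Δη₀|)`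
with an integrable right-hand side, for `η₀ ≥ 0` a test function on `{t < 0}` and `Φ ≥ k > 0` at
the regular axis points of its support. Proof: test with `η₀ · G(∑ᵢ ψᵢ)` (siblings
`…ExcisionCutoff`, `…ParabolicBumps`: bumps covering `S ∩ tsupport η₀`, `∑ rᵢ ≤ δ`), bound the
four terms pointwise (convexity of `G` for the Laplacian), and let `δ → 0` (costs `O(∑ rᵢ)`,
siblings `…ExcisionEstimates`, `…ExcisionError`).

## References

* G. Seregin, Anal. Math. Phys. 10 (2020), Paper 46 = arXiv:2006.04140, Lemma 2.2 and the first
  lines of its proof, class 𝒱 (i) (arXiv p. 8). [Seregin2020]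
* A. I. Nazarov, N. N. Uraltseva, St. Petersburg Math. J. 23 (2012) 93–115 = arXiv:1011.1888,
  proof of Lemma 4.2, (4.5)–(4.6). [NazarovUraltseva2012]
-/

-- the problem directory repeats the summit name (D-0017); core's `dupNamespace` linter fires
set_option linter.dupNamespace false

noncomputable section

open MeasureTheory Set Function Filter Topology TopologicalSpace Metric
open scoped NNReal ENNReal InnerProductSpace Laplacian

namespace Summit.NavierStokesRegularity.NavierStokesRegularity.Theorems.AxisymmetricKatoGlobal.EulerScaling

open Literature.Analysis.FluidPDE Literature.Analysis.FluidPDE.Seregin2020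
  Literature.Analysis.FluidPDE.SereginZajaczkowski2007

/-- **The very weak inequality across the singular set.** Setting of `hWH′` (class 𝒱: `S` closed,
on the axis, `𝒫¹`-null; `Φ` continuous with `C^∞` slices and continuous first/second slice
derivatives off `S`, classical `∂ₜΦ` off the axis, `0 ≤ Φ ≤ B` off `S`; drift `U` continuous with
smooth divergence-free slices off the axis; SUPERsolution inequality off the axis). For every
nonnegative space–time test function `η₀` on the open half-space `{t < 0}` (its support may meet
`S`) with `U ∈ L³(tsupport η₀)`, and every `k > 0` with `Φ ≥ k` at the axis points of
`tsupport η₀` outside `S`: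
`4πk ∫∫ η₀(t,(0,0,x₃)) dx₃ dt ≤ ∫∫ Φ (|∂ₜη₀| + ‖U‖‖Dη₀‖ + (2/ϱ)‖Dη₀‖ + |Δη₀|)`, and the
right-hand integrand is integrable. [cite: Seregin2020, proof of Lemma 2.2 (arXiv p. 8): the displayed inequality holds for π ∈ 𝒱; NazarovUraltseva2012 (4.5)–(4.6)] -/
theorem veryWeak_supersolution_axis_acrossS (Φ : ℝ → EuclideanSpace ℝ (Fin 3) → ℝ) (U : ℝ → EuclideanSpace ℝ (Fin 3) → EuclideanSpace ℝ (Fin 3)) (S : Set (ℝ × EuclideanSpace ℝ (Fin 3)))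
    (hS : IsClosed S) (hSax : ∀ z ∈ S, cylRadius z.2 = 0) (hSnull : IsParabolicNull 1 S) (hΦc : ContinuousOn (uncurry Φ) ({z : ℝ × EuclideanSpace ℝ (Fin 3) | z.1 < 0} \ S))
    (hΦs : ∀ z : ℝ × EuclideanSpace ℝ (Fin 3), z.1 < 0 → z ∉ S → ContDiffAt ℝ (⊤ : ℕ∞) (Φ z.1) z.2) (hΦg : ContinuousOn (fun z : ℝ × EuclideanSpace ℝ (Fin 3) => fderiv ℝ (Φ z.1) z.2)
      ({z : ℝ × EuclideanSpace ℝ (Fin 3) | z.1 < 0} \ S)) (hΦ2 : ∀ e : EuclideanSpace ℝ (Fin 3), ContinuousOn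
      (fun z : ℝ × EuclideanSpace ℝ (Fin 3) => fderiv ℝ (fun y => fderiv ℝ (Φ z.1) y e) z.2 e) ({z : ℝ × EuclideanSpace ℝ (Fin 3) | z.1 < 0} \ S))
    (hΦt : ∀ z : ℝ × EuclideanSpace ℝ (Fin 3), z.1 < 0 → cylRadius z.2 ≠ 0 → DifferentiableAt ℝ (fun r => Φ r z.2) z.1)
    (hΦt' : ContinuousOn (fun z : ℝ × EuclideanSpace ℝ (Fin 3) => deriv (fun r => Φ r z.2) z.1) {z : ℝ × EuclideanSpace ℝ (Fin 3) | z.1 < 0 ∧ cylRadius z.2 ≠ 0})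
    (hB : ∃ B : ℝ, ∀ z : ℝ × EuclideanSpace ℝ (Fin 3), z.1 < 0 → z ∉ S → |Φ z.1 z.2| ≤ B) (hpos : ∀ z : ℝ × EuclideanSpace ℝ (Fin 3), z.1 < 0 → z ∉ S → 0 ≤ Φ z.1 z.2)
    (hUc : ContinuousOn (uncurry U) {z : ℝ × EuclideanSpace ℝ (Fin 3) | z.1 < 0 ∧ cylRadius z.2 ≠ 0})
    (hUs : ∀ z : ℝ × EuclideanSpace ℝ (Fin 3), z.1 < 0 → cylRadius z.2 ≠ 0 → ContDiffAt ℝ (⊤ : ℕ∞) (U z.1) z.2) (hdiv : ∀ z : ℝ × EuclideanSpace ℝ (Fin 3), z.1 < 0 → cylRadius z.2 ≠ 0 →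
      VectorCalculus.divergence (U z.1) z.2 = 0) (hsup : ∀ z : ℝ × EuclideanSpace ℝ (Fin 3), z.1 < 0 → cylRadius z.2 ≠ 0 →
      0 ≤ deriv (fun r => Φ r z.2) z.1 + fderiv ℝ (Φ z.1) z.2 (U z.1 z.2) + 2 / cylRadius z.2 * partialDeriv (eR z.2) (Φ z.1) z.2 - (Δ (Φ z.1)) z.2)
    (η₀ : ℝ → EuclideanSpace ℝ (Fin 3) → ℝ) (hη₀ : IsSpaceTimeTestOn ⟨{w : ℝ × EuclideanSpace ℝ (Fin 3) | w.1 < 0}, isOpen_lt continuous_fst continuous_const⟩ η₀)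
    (hη₀0 : ∀ t x, 0 ≤ η₀ t x) (hU3 : ∫⁻ z in tsupport (uncurry η₀), ‖U z.1 z.2‖ₑ ^ (3 : ℕ) < ∞) (k : ℝ) (hk : 0 < k)
    (hax : ∀ z ∈ tsupport (uncurry η₀), cylRadius z.2 = 0 → z ∉ S → k ≤ Φ z.1 z.2) :
    4 * Real.pi * k * ∫ p : ℝ × ℝ, η₀ p.1 (meridianPoint (0, p.2)) ≤ ∫ z : ℝ × EuclideanSpace ℝ (Fin 3), Φ z.1 z.2 * (|deriv (fun s => η₀ s z.2) z.1| +
        ‖U z.1 z.2‖ * ‖fderiv ℝ (η₀ z.1) z.2‖ + 2 / cylRadius z.2 * ‖fderiv ℝ (η₀ z.1) z.2‖ + |(Δ (η₀ z.1)) z.2|) ∧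
    Integrable (fun z : ℝ × EuclideanSpace ℝ (Fin 3) => Φ z.1 z.2 * (|deriv (fun s => η₀ s z.2) z.1| +
        ‖U z.1 z.2‖ * ‖fderiv ℝ (η₀ z.1) z.2‖ + 2 / cylRadius z.2 * ‖fderiv ℝ (η₀ z.1) z.2‖ + |(Δ (η₀ z.1)) z.2|)):= by
  classical
  set K : Set (ℝ × EuclideanSpace ℝ (Fin 3)) := tsupport (uncurry η₀) with hK
  have hKc : IsCompact K := hη₀.hasCompactSupport
  have hKW : K ⊆ {w : ℝ × EuclideanSpace ℝ (Fin 3) | w.1 < 0} := hη₀.tsupport_subset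
  have hKm : MeasurableSet K := hKc.isClosed.measurableSet
  have hW₀o : IsOpen {w : ℝ × EuclideanSpace ℝ (Fin 3) | w.1 < 0} := isOpen_lt continuous_fst continuous_const
  set W : Opens (ℝ × EuclideanSpace ℝ (Fin 3)) := ⟨{w : ℝ × EuclideanSpace ℝ (Fin 3) | w.1 < 0} \ S, hW₀o.sdiff hS⟩ with hWdef
  have hSnullV : volume S = 0 := measure_mono_null (fun z hz => hSax z hz) volume_setOf_cylRadius_snd_eq_zero
  have haeS : ∀ᵐ z : ℝ × EuclideanSpace ℝ (Fin 3), z ∉ S := measure_eq_zero_iff_ae_notMem.1 hSnullV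
  obtain ⟨B, hB⟩ := hB
  set B' : ℝ := max B 0 with hB'
  have hB'0 : 0 ≤ B' := le_max_right _ _
  have hΦB : ∀ z : ℝ × EuclideanSpace ℝ (Fin 3), z.1 < 0 → z ∉ S → Φ z.1 z.2 ≤ B' := fun z hz hzS =>
    (le_abs_self _).trans ((hB z hz hzS).trans (le_max_left _ _))
  obtain ⟨M₀, hM₀0, hM₀⟩ := exists_norm_le_of_hasCompactSupport hη₀.contDiff.continuous hη₀.hasCompactSupport
  have hη₀M : ∀ t x, η₀ t x ≤ M₀ := fun t x => (le_abs_self _).trans (by simpa [Real.norm_eq_abs] using hM₀ (t, x))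
  have hη₀K : ∀ z : ℝ × EuclideanSpace ℝ (Fin 3), z ∉ K → η₀ z.1 z.2 = 0 := fun z hz =>
    (image_eq_zero_of_notMem_tsupport hz : uncurry η₀ z = 0)
  have hDc : Continuous fun z : ℝ × EuclideanSpace ℝ (Fin 3) => fderiv ℝ (η₀ z.1) z.2 := continuous_fderiv_slice hη₀
  have hD0 : ∀ z : ℝ × EuclideanSpace ℝ (Fin 3), z ∉ K → fderiv ℝ (η₀ z.1) z.2 = 0 := fun z hz => fderiv_slice_eq_zero_of_notMem hz
  obtain ⟨M₁, hM₁0, hM₁⟩ := exists_norm_le_of_hasCompactSupport hDc (HasCompactSupport.intro hKc hD0)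
  have hTc : Continuous fun z : ℝ × EuclideanSpace ℝ (Fin 3) => deriv (fun s => η₀ s z.2) z.1 := continuous_timeDeriv_slice hη₀
  have hT0 : ∀ z : ℝ × EuclideanSpace ℝ (Fin 3), z ∉ K → deriv (fun s => η₀ s z.2) z.1 = 0 := fun z hz => timeDeriv_slice_eq_zero_of_notMem hz
  have hLc : Continuous fun z : ℝ × EuclideanSpace ℝ (Fin 3) => (Δ (η₀ z.1)) z.2 := continuous_laplacian_slice_of_uncurry hη₀.contDiff
  have hL0 : ∀ z : ℝ × EuclideanSpace ℝ (Fin 3), z ∉ K → (Δ (η₀ z.1)) z.2 = 0 := fun z hz => laplacian_slice_eq_zero_of_notMem hz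
  have hΦm : AEStronglyMeasurable (K.indicator (uncurry Φ)) volume := by
    refine aestronglyMeasurable_indicator_of_continuousOn_offAxis_real hW₀o hKc hKW (hΦc.mono ?_)
    rintro z ⟨hz, hρ⟩
    exact ⟨hz, fun hzS => hρ (hSax z hzS)⟩
  have hΦbd : ∀ᵐ z : ℝ × EuclideanSpace ℝ (Fin 3), ‖K.indicator (uncurry Φ) z‖ ≤ B' := by
    filter_upwards [haeS] with z hzS
    by_cases hz : z ∈ K
    · rw [indicator_of_mem hz]
      show ‖Φ z.1 z.2‖ ≤ B'
      rw [Real.norm_eq_abs, abs_of_nonneg (hpos z (hKW hz) hzS)]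
      exact hΦB z (hKW hz) hzS
    · rw [indicator_of_notMem hz, norm_zero]; exact hB'0
  have hUm : AEStronglyMeasurable (K.indicator (uncurry U)) volume := aestronglyMeasurable_indicator_of_continuousOn_offAxis hW₀o hKc hKW hUc
  obtain ⟨hUρ, hU1⟩ := integrable_norm_div_cylRadius_of_lintegral_cube hKc hUm hU3
  have hU3i : IntegrableOn (fun z : ℝ × EuclideanSpace ℝ (Fin 3) => ‖U z.1 z.2‖ ^ 3) K := by
    have hUK : AEStronglyMeasurable (uncurry U) (volume.restrict K) := (aestronglyMeasurable_indicator_iff hKm).1 hUm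
    refine ⟨(hUK.norm.pow 3), ?_⟩
    rw [HasFiniteIntegral]
    refine lt_of_le_of_lt (lintegral_mono fun z => ?_) hU3
    rw [Real.enorm_eq_ofReal (by positivity), ← ofReal_norm, ← ENNReal.ofReal_pow (norm_nonneg _)]
  set I3 : ℝ := ∫ w in K, ‖U w.1 w.2‖ ^ 3 with hI3
  have hI30 : 0 ≤ I3 := integral_nonneg fun w => by positivity
  have hU1' : Integrable (K.indicator fun w : ℝ × EuclideanSpace ℝ (Fin 3) => ‖U w.1 w.2‖) := (integrable_indicator_iff hKm).2 hU1
  obtain ⟨Φ', hΦ'⟩ : ∃ Φ' : ℝ × EuclideanSpace ℝ (Fin 3) → ℝ, Φ' = K.indicator (uncurry Φ) := ⟨_, rfl⟩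
  have hΦ'K : ∀ w ∈ K, Φ' w = Φ w.1 w.2 := fun w hw => by rw [hΦ', indicator_of_mem hw]; rfl
  have iT₀ : Integrable (fun w : ℝ × EuclideanSpace ℝ (Fin 3) => |deriv (fun τ => η₀ τ w.2) w.1|) :=
    (hTc.abs).integrable_of_hasCompactSupport (HasCompactSupport.intro hKc fun w hw => by simp [hT0 w hw])
  have iL₀ : Integrable (fun w : ℝ × EuclideanSpace ℝ (Fin 3) => |(Δ (η₀ w.1)) w.2|) := (hLc.abs).integrable_of_hasCompactSupport (HasCompactSupport.intro hKc fun w hw => by simp [hL0 w hw])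
  have iUD₀ : Integrable (fun w : ℝ × EuclideanSpace ℝ (Fin 3) =>
      K.indicator (fun w : ℝ × EuclideanSpace ℝ (Fin 3) => ‖U w.1 w.2‖) w * ‖fderiv ℝ (η₀ w.1) w.2‖) := hU1'.mul_bdd hDc.norm.aestronglyMeasurable (Eventually.of_forall fun w => by
      rw [norm_norm]; exact hM₁ w)
  have iR₀ : Integrable (fun w : ℝ × EuclideanSpace ℝ (Fin 3) =>
      K.indicator (fun w : ℝ × EuclideanSpace ℝ (Fin 3) => (cylRadius w.2)⁻¹) w * (2 * ‖fderiv ℝ (η₀ w.1) w.2‖)) :=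
    ((integrable_indicator_iff hKm).2 (integrableOn_inv_cylRadius_snd hKc)).mul_bdd
      ((continuous_const.mul hDc.norm).aestronglyMeasurable) (Eventually.of_forall fun w => by
        rw [Real.norm_eq_abs, abs_of_nonneg (by positivity)]
        exact mul_le_mul_of_nonneg_left (hM₁ w) zero_le_two)
  have hΦ'm : AEStronglyMeasurable Φ' volume := by rw [hΦ']; exact hΦm
  have hΦ'bd : ∀ᵐ z : ℝ × EuclideanSpace ℝ (Fin 3), ‖Φ' z‖ ≤ B' := by rw [hΦ']; exact hΦbd
  have im₁ : Integrable (fun w : ℝ × EuclideanSpace ℝ (Fin 3) => Φ' w * |deriv (fun τ => η₀ τ w.2) w.1|) := iT₀.bdd_mul hΦ'm hΦ'bd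
  have im₂ : Integrable (fun w : ℝ × EuclideanSpace ℝ (Fin 3) => Φ' w *
      (K.indicator (fun w : ℝ × EuclideanSpace ℝ (Fin 3) => ‖U w.1 w.2‖) w * ‖fderiv ℝ (η₀ w.1) w.2‖)) := iUD₀.bdd_mul hΦ'm hΦ'bd
  have im₃ : Integrable (fun w : ℝ × EuclideanSpace ℝ (Fin 3) => Φ' w *
      (K.indicator (fun w : ℝ × EuclideanSpace ℝ (Fin 3) => (cylRadius w.2)⁻¹) w * (2 * ‖fderiv ℝ (η₀ w.1) w.2‖))) := iR₀.bdd_mul hΦ'm hΦ'bd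
  have im₄ : Integrable (fun w : ℝ × EuclideanSpace ℝ (Fin 3) => Φ' w * |(Δ (η₀ w.1)) w.2|) := iL₀.bdd_mul hΦ'm hΦ'bd
  have hmeq : ∀ w : ℝ × EuclideanSpace ℝ (Fin 3), Φ w.1 w.2 * (|deriv (fun τ => η₀ τ w.2) w.1| +
      ‖U w.1 w.2‖ * ‖fderiv ℝ (η₀ w.1) w.2‖ + 2 / cylRadius w.2 * ‖fderiv ℝ (η₀ w.1) w.2‖ + |(Δ (η₀ w.1)) w.2|) =
      Φ' w * |deriv (fun τ => η₀ τ w.2) w.1| +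
      Φ' w * (K.indicator (fun w : ℝ × EuclideanSpace ℝ (Fin 3) => ‖U w.1 w.2‖) w * ‖fderiv ℝ (η₀ w.1) w.2‖) +
      Φ' w * (K.indicator (fun w : ℝ × EuclideanSpace ℝ (Fin 3) => (cylRadius w.2)⁻¹) w * (2 * ‖fderiv ℝ (η₀ w.1) w.2‖)) +
      Φ' w * |(Δ (η₀ w.1)) w.2| := by
    intro w
    by_cases hw : w ∈ K
    · rw [hΦ'K w hw, indicator_of_mem hw, indicator_of_mem hw]; ring
    · rw [hT0 w hw, hD0 w hw, hL0 w hw]; simp [hΦ', indicator_of_notMem hw]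
  have hmi : Integrable (fun w : ℝ × EuclideanSpace ℝ (Fin 3) => Φ w.1 w.2 * (|deriv (fun τ => η₀ τ w.2) w.1| +
      ‖U w.1 w.2‖ * ‖fderiv ℝ (η₀ w.1) w.2‖ + 2 / cylRadius w.2 * ‖fderiv ℝ (η₀ w.1) w.2‖ + |(Δ (η₀ w.1)) w.2|)) := by
    have h := ((im₁.add im₂).add im₃).add im₄
    exact h.congr (Eventually.of_forall fun w => (hmeq w).symm)
  refine ⟨?_, hmi⟩
  obtain ⟨A, hA0, hA⟩ := exists_parabolicBump_deriv_bounds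
  obtain ⟨Cax, hCax0, hCax⟩ := exists_lintegral_inv_cylRadius_parabolicBox_le
  obtain ⟨G, hG⟩ : ∃ G : ℝ → ℝ, ∀ v, G v = Real.exp 2 * expNegInvGlue ((1 - v) / 2) := ⟨_, fun _ => rfl⟩
  obtain ⟨-, -, -, -, -, -, -, C, hC0, hC⟩ := exciseProfile_props hG
  have hBMC : 0 ≤ B' * M₀ * C := mul_nonneg (mul_nonneg hB'0 hM₀0) hC0
  have hBM1C : 0 ≤ 6 * B' * M₁ * C := mul_nonneg (mul_nonneg (mul_nonneg (by norm_num) hB'0) hM₁0) hC0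
  have hkπ : 0 ≤ 4 * Real.pi * k := mul_nonneg (mul_nonneg (by norm_num) Real.pi_pos.le) hk.le
  set Cerr : ℝ := B' * M₀ * C * (135 * A) + B' * M₀ * C * (A * (I3 + 135)) + 2 * (B' * M₀ * C) * (A * Cax) +
    (B' * M₀ * C * (135 * A) + 6 * B' * M₁ * C * (135 * A)) + 4 * Real.pi * k * (16 * M₀) with hCerr
  have hCerr0 : 0 ≤ Cerr := by
    have h1 : 0 ≤ B' * M₀ * C * (135 * A) := mul_nonneg hBMC (by nlinarith)
    have h2 : 0 ≤ B' * M₀ * C * (A * (I3 + 135)) := mul_nonneg hBMC (mul_nonneg hA0 (by linarith))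
    have h3 : 0 ≤ 2 * (B' * M₀ * C) * (A * Cax) := mul_nonneg (mul_nonneg zero_le_two hBMC) (mul_nonneg hA0 hCax0)
    have h4 : 0 ≤ 6 * B' * M₁ * C * (135 * A) := mul_nonneg hBM1C (by nlinarith)
    have h5 : 0 ≤ 4 * Real.pi * k * (16 * M₀) := mul_nonneg hkπ (by nlinarith)
    rw [hCerr]; linarith
  refine le_of_forall_pos_le_add fun ε hε => ?_
  set δ : ℝ := ε / (Cerr + 1) with hδ
  have hδ0 : 0 < δ := div_pos hε (by linarith)
  have hCδ : Cerr * δ ≤ ε := by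
    rw [hδ, mul_div_assoc']
    rw [div_le_iff₀ (by linarith)]
    nlinarith
  obtain ⟨s, z, r, hr, hcov, hsum⟩ := exists_finite_parabolic_cover hSnull (hKc.inter_left hS) Set.inter_subset_left hδ0
  have hr' : ∀ i ∈ s, 0 < r i := fun i hi => (hr i hi).1
  have hsum0 : 0 ≤ ∑ i ∈ s, r i := Finset.sum_nonneg fun i hi => (hr' i hi).le
  obtain ⟨ψ, hψall⟩ : ∃ ψ : ℕ → ℝ → EuclideanSpace ℝ (Fin 3) → ℝ,
      ∀ i t x, ψ i t x = cutoff (r i ^ 2) (t - (z i).1) * cutoff (r i) (x - (z i).2) := ⟨_, fun _ _ _ => rfl⟩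
  have hψ : ∀ i ∈ s, ∀ t x, ψ i t x = cutoff (r i ^ 2) (t - (z i).1) * cutoff (r i) (x - (z i).2) := fun i _ t x => hψall i t x
  obtain ⟨σ, hσ⟩ : ∃ σ : ℝ → EuclideanSpace ℝ (Fin 3) → ℝ, ∀ t x, σ t x = ∑ i ∈ s, ψ i t x := ⟨_, fun _ _ => rfl⟩
  obtain ⟨g, hg⟩ : ∃ g : ℝ → EuclideanSpace ℝ (Fin 3) → ℝ, ∀ t x, g t x = G (σ t x) := ⟨_, fun _ _ => rfl⟩
  obtain ⟨η, hη⟩ : ∃ η : ℝ → EuclideanSpace ℝ (Fin 3) → ℝ, ∀ t x, η t x = η₀ t x * g t x := ⟨_, fun _ _ => rfl⟩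
  have hcov' : S ∩ tsupport (uncurry η₀) ⊆ ⋃ i ∈ s, parabolicCylinderCentered (r i) (z i) := hcov
  have hA' : ∀ i ∈ s, ∀ (t : ℝ) (x : EuclideanSpace ℝ (Fin 3)),
      |deriv (fun τ => ψ i τ x) t| ≤ A / r i ^ 2 ∧ ‖fderiv ℝ (ψ i t) x‖ ≤ A / r i ∧ |(Δ (ψ i t)) x| ≤ A / r i ^ 2 := fun i hi t x => hA (r i) (z i).1 (z i).2 (hr' i hi) (ψ i) (hψ i hi) t x
  obtain ⟨htest, hηnn, hηle, htsupp, hdt, hdx, hdl⟩ := excisedTest_props s hr' hψ hσ hG hg hC hS hη₀ hη₀0 hcov' hη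
  have hsubW : ((W : Set (ℝ × EuclideanSpace ℝ (Fin 3))) ∩ {w | cylRadius w.2 ≠ 0}) ⊆
      {w : ℝ × EuclideanSpace ℝ (Fin 3) | w.1 < 0 ∧ cylRadius w.2 ≠ 0} := fun w hw => ⟨hw.1.1, hw.2⟩
  have hmain := veryWeak_supersolution_axis_lowerBound W Φ U hΦc
    (fun w hw => (hΦs w hw.1 hw.2).of_le (by norm_cast)) hΦg hΦ2 (fun w hw hρ => hΦt w hw.1 hρ)
    (hΦt'.mono hsubW) (hUc.mono hsubW) (fun w hw hρ => (hUs w hw.1 hρ).of_le (by norm_cast))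
    (fun w hw hρ => hdiv w hw.1 hρ) (fun w hw hρ => hsup w hw.1 hρ) η htest hηnn
    (lt_of_le_of_lt (lintegral_mono_set htsupp) hU3) k
    (fun w hw hρ => hax w (htsupp hw) hρ (htest.tsupport_subset hw).2)
  obtain ⟨⟨iE₁, bE₁⟩, ⟨iE₂, bE₂⟩, ⟨iE₃, bE₃⟩, ⟨iE₄, bE₄⟩, ⟨iE₅, bE₅⟩⟩ := excision_error_integrals_le s hr hψ hA0 hA' hCax0 hCax hKc hU1' hU3i
  have hderivη0 : ∀ w : ℝ × EuclideanSpace ℝ (Fin 3), w ∉ K →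
      deriv (fun τ => η τ w.2) w.1 = 0 ∧ fderiv ℝ (η w.1) w.2 = 0 ∧ (Δ (η w.1)) w.2 = 0 := fun w hw =>
    ⟨timeDeriv_slice_eq_zero_of_notMem fun h => hw (htsupp h), fderiv_slice_eq_zero_of_notMem fun h => hw (htsupp h),
      laplacian_slice_eq_zero_of_notMem fun h => hw (htsupp h)⟩
  have hΦη₀ : ∀ w ∈ K, w ∉ S → Φ w.1 w.2 * η₀ w.1 w.2 ≤ B' * M₀ := fun w hw hwS =>
    mul_le_mul (hΦB w (hKW hw) hwS) (hη₀M _ _) (hη₀0 _ _) hB'0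
  have hT1 : -(∫ w : ℝ × EuclideanSpace ℝ (Fin 3), Φ w.1 w.2 * timeDeriv η w.1 w.2) ≤ (∫ w : ℝ × EuclideanSpace ℝ (Fin 3), Φ' w * |deriv (fun τ => η₀ τ w.2) w.1|) +
      B' * M₀ * C * ∫ w : ℝ × EuclideanSpace ℝ (Fin 3), ∑ i ∈ s, |deriv (fun τ => ψ i τ w.2) w.1| := by
    have hgi : Integrable (fun w : ℝ × EuclideanSpace ℝ (Fin 3) => Φ' w * |deriv (fun τ => η₀ τ w.2) w.1| +
        B' * M₀ * C * ∑ i ∈ s, |deriv (fun τ => ψ i τ w.2) w.1|) := im₁.add (iE₁.const_mul (B' * M₀ * C))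
    have key := neg_integral_le_integral_of_le (f := fun w : ℝ × EuclideanSpace ℝ (Fin 3) => Φ w.1 w.2 * timeDeriv η w.1 w.2)
      hgi ?_ ?_
    · rw [integral_add im₁ (iE₁.const_mul (B' * M₀ * C)), integral_const_mul] at key
      exact key
    · filter_upwards [haeS] with w hwS
      have hs0 : 0 ≤ B' * M₀ * C * ∑ i ∈ s, |deriv (fun τ => ψ i τ w.2) w.1| := mul_nonneg hBMC (Finset.sum_nonneg fun i _ => abs_nonneg _)
      by_cases hw : w ∈ K
      · rw [hΦ'K w hw]
        exact add_nonneg (mul_nonneg (hpos w (hKW hw) hwS) (abs_nonneg _)) hs0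
      · rw [hΦ', indicator_of_notMem hw, zero_mul, zero_add]
        exact hs0
    · filter_upwards [haeS] with w hwS
      by_cases hw : w ∈ K
      · rw [hΦ'K w hw, timeDeriv_apply]
        have hΦ0 := hpos w (hKW hw) hwS
        have h1 : -(Φ w.1 w.2 * deriv (fun τ => η τ w.2) w.1) ≤ Φ w.1 w.2 * |deriv (fun τ => η τ w.2) w.1| := by
          rw [← mul_neg]; exact mul_le_mul_of_nonneg_left (neg_le_abs _) hΦ0
        have h2 := mul_le_mul_of_nonneg_left (hdt w.1 w.2) hΦ0
        have hs0 : 0 ≤ C * ∑ i ∈ s, |deriv (fun τ => ψ i τ w.2) w.1| := mul_nonneg hC0 (Finset.sum_nonneg fun i _ => abs_nonneg _)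
        have h3 := mul_le_mul_of_nonneg_right (hΦη₀ w hw hwS) hs0
        linear_combination h1 + h2 + h3
      · rw [timeDeriv_apply, (hderivη0 w hw).1, hΦ']
        simp only [mul_zero, neg_zero, indicator_of_notMem hw, zero_mul, zero_add]
        exact mul_nonneg hBMC (Finset.sum_nonneg fun i _ => abs_nonneg _)
  have hT2 : -(∫ w : ℝ × EuclideanSpace ℝ (Fin 3), Φ w.1 w.2 * fderiv ℝ (η w.1) w.2 (U w.1 w.2)) ≤ (∫ w : ℝ × EuclideanSpace ℝ (Fin 3), Φ' w *
        (K.indicator (fun w : ℝ × EuclideanSpace ℝ (Fin 3) => ‖U w.1 w.2‖) w * ‖fderiv ℝ (η₀ w.1) w.2‖)) +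
      B' * M₀ * C * ∫ w : ℝ × EuclideanSpace ℝ (Fin 3), ∑ i ∈ s,
        K.indicator (fun w : ℝ × EuclideanSpace ℝ (Fin 3) => ‖U w.1 w.2‖) w * ‖fderiv ℝ (ψ i w.1) w.2‖ := by
    have hgi : Integrable (fun w : ℝ × EuclideanSpace ℝ (Fin 3) => Φ' w *
        (K.indicator (fun w : ℝ × EuclideanSpace ℝ (Fin 3) => ‖U w.1 w.2‖) w * ‖fderiv ℝ (η₀ w.1) w.2‖) +
        B' * M₀ * C * ∑ i ∈ s, K.indicator (fun w : ℝ × EuclideanSpace ℝ (Fin 3) => ‖U w.1 w.2‖) w * ‖fderiv ℝ (ψ i w.1) w.2‖) := im₂.add (iE₂.const_mul (B' * M₀ * C))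
    have key := neg_integral_le_integral_of_le
      (f := fun w : ℝ × EuclideanSpace ℝ (Fin 3) => Φ w.1 w.2 * fderiv ℝ (η w.1) w.2 (U w.1 w.2)) hgi ?_ ?_
    · rw [integral_add im₂ (iE₂.const_mul (B' * M₀ * C)), integral_const_mul] at key
      exact key
    · filter_upwards [haeS] with w hwS
      by_cases hw : w ∈ K
      · rw [hΦ'K w hw, indicator_of_mem hw]
        exact add_nonneg (mul_nonneg (hpos w (hKW hw) hwS) (mul_nonneg (norm_nonneg _) (norm_nonneg _)))
          (mul_nonneg hBMC (Finset.sum_nonneg fun i _ => mul_nonneg (norm_nonneg _) (norm_nonneg _)))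
      · simp only [hΦ', indicator_of_notMem hw, zero_mul, zero_add, Finset.sum_const_zero, mul_zero]
        exact le_rfl
    · filter_upwards [haeS] with w hwS
      by_cases hw : w ∈ K
      · rw [hΦ'K w hw, indicator_of_mem hw, ← Finset.mul_sum]
        have hΦ0 := hpos w (hKW hw) hwS
        have h1 : -(Φ w.1 w.2 * fderiv ℝ (η w.1) w.2 (U w.1 w.2)) ≤ Φ w.1 w.2 * (‖fderiv ℝ (η w.1) w.2‖ * ‖U w.1 w.2‖) := by
          rw [← mul_neg]
          refine mul_le_mul_of_nonneg_left ((neg_le_abs _).trans ?_) hΦ0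
          rw [← Real.norm_eq_abs]; exact ContinuousLinearMap.le_opNorm _ _
        have h2 : ‖fderiv ℝ (η w.1) w.2‖ * ‖U w.1 w.2‖ ≤ (‖fderiv ℝ (η₀ w.1) w.2‖ + η₀ w.1 w.2 * (C * ∑ i ∈ s, ‖fderiv ℝ (ψ i w.1) w.2‖)) * ‖U w.1 w.2‖ :=
          mul_le_mul_of_nonneg_right (hdx w.1 w.2) (norm_nonneg _)
        have h2' := mul_le_mul_of_nonneg_left h2 hΦ0
        have hs0 : 0 ≤ C * ∑ i ∈ s, ‖fderiv ℝ (ψ i w.1) w.2‖ := mul_nonneg hC0 (Finset.sum_nonneg fun i _ => norm_nonneg _)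
        have h3 := mul_le_mul_of_nonneg_right (hΦη₀ w hw hwS) (mul_nonneg hs0 (norm_nonneg (U w.1 w.2)))
        linear_combination h1 + h2' + h3
      · rw [(hderivη0 w hw).2.1, hΦ']
        simp only [zero_apply, mul_zero, neg_zero, indicator_of_notMem hw, zero_mul, zero_add, Finset.sum_const_zero, le_refl]
  have hT3 : -(∫ w : ℝ × EuclideanSpace ℝ (Fin 3), Φ w.1 w.2 * (2 / cylRadius w.2 * partialDeriv (eR w.2) (η w.1) w.2)) ≤ (∫ w : ℝ × EuclideanSpace ℝ (Fin 3), Φ' w *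
        (K.indicator (fun w : ℝ × EuclideanSpace ℝ (Fin 3) => (cylRadius w.2)⁻¹) w * (2 * ‖fderiv ℝ (η₀ w.1) w.2‖))) +
      2 * (B' * M₀ * C) * ∫ w : ℝ × EuclideanSpace ℝ (Fin 3), ∑ i ∈ s, (cylRadius w.2)⁻¹ * ‖fderiv ℝ (ψ i w.1) w.2‖ := by
    have hgi : Integrable (fun w : ℝ × EuclideanSpace ℝ (Fin 3) => Φ' w *
        (K.indicator (fun w : ℝ × EuclideanSpace ℝ (Fin 3) => (cylRadius w.2)⁻¹) w * (2 * ‖fderiv ℝ (η₀ w.1) w.2‖)) +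
        2 * (B' * M₀ * C) * ∑ i ∈ s, (cylRadius w.2)⁻¹ * ‖fderiv ℝ (ψ i w.1) w.2‖) := im₃.add (iE₃.const_mul (2 * (B' * M₀ * C)))
    have key := neg_integral_le_integral_of_le
      (f := fun w : ℝ × EuclideanSpace ℝ (Fin 3) => Φ w.1 w.2 * (2 / cylRadius w.2 * partialDeriv (eR w.2) (η w.1) w.2)) hgi ?_ ?_
    · rw [integral_add im₃ (iE₃.const_mul (2 * (B' * M₀ * C))), integral_const_mul] at key
      exact key
    · filter_upwards [haeS] with w hwS
      by_cases hw : w ∈ K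
      · rw [hΦ'K w hw, indicator_of_mem hw]
        have hρinv : 0 ≤ (cylRadius w.2)⁻¹ := inv_nonneg.2 (cylRadius_nonneg _)
        exact add_nonneg (mul_nonneg (hpos w (hKW hw) hwS) (mul_nonneg hρinv (mul_nonneg zero_le_two (norm_nonneg _))))
          (mul_nonneg (mul_nonneg zero_le_two hBMC) (Finset.sum_nonneg fun i _ => mul_nonneg hρinv (norm_nonneg _)))
      · simp only [hΦ', indicator_of_notMem hw, zero_mul, zero_add]
        have : 0 ≤ ∑ i ∈ s, (cylRadius w.2)⁻¹ * ‖fderiv ℝ (ψ i w.1) w.2‖ := Finset.sum_nonneg fun i _ => mul_nonneg (inv_nonneg.2 (cylRadius_nonneg _)) (norm_nonneg _)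
        exact mul_nonneg (mul_nonneg zero_le_two hBMC) this
    · filter_upwards [haeS] with w hwS
      have hρ0 : 0 ≤ (cylRadius w.2)⁻¹ := inv_nonneg.2 (cylRadius_nonneg _)
      have h2ρ : 0 ≤ 2 / cylRadius w.2 := div_nonneg zero_le_two (cylRadius_nonneg _)
      by_cases hw : w ∈ K
      · rw [hΦ'K w hw, indicator_of_mem hw, partialDeriv_apply, ← Finset.mul_sum]
        have hΦ0 := hpos w (hKW hw) hwS
        have hD : |fderiv ℝ (η w.1) w.2 (eR w.2)| ≤ ‖fderiv ℝ (η w.1) w.2‖ := by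
          rw [← Real.norm_eq_abs]
          refine (ContinuousLinearMap.le_opNorm _ _).trans ?_
          exact mul_le_of_le_one_right (norm_nonneg _) (norm_eR_le_one _)
        have h1 : -(Φ w.1 w.2 * (2 / cylRadius w.2 * fderiv ℝ (η w.1) w.2 (eR w.2))) ≤ Φ w.1 w.2 * (2 / cylRadius w.2 * ‖fderiv ℝ (η w.1) w.2‖) := by
          rw [← mul_neg, ← mul_neg]
          exact mul_le_mul_of_nonneg_left (mul_le_mul_of_nonneg_left ((neg_le_abs _).trans hD) h2ρ) hΦ0
        have h2' := mul_le_mul_of_nonneg_left (mul_le_mul_of_nonneg_left (hdx w.1 w.2) h2ρ) hΦ0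
        have hs0 : 0 ≤ C * ∑ i ∈ s, ‖fderiv ℝ (ψ i w.1) w.2‖ := mul_nonneg hC0 (Finset.sum_nonneg fun i _ => norm_nonneg _)
        have h3 := mul_le_mul_of_nonneg_right (hΦη₀ w hw hwS) (mul_nonneg h2ρ hs0)
        have eρ : (2 : ℝ) / cylRadius w.2 = 2 * (cylRadius w.2)⁻¹ := div_eq_mul_inv _ _
        rw [eρ] at h1 h2' h3
        linear_combination h1 + h2' + h3
      · rw [partialDeriv_apply, (hderivη0 w hw).2.1, hΦ']
        simp only [zero_apply, mul_zero, neg_zero, indicator_of_notMem hw, zero_mul, zero_add]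
        have : 0 ≤ ∑ i ∈ s, (cylRadius w.2)⁻¹ * ‖fderiv ℝ (ψ i w.1) w.2‖ := Finset.sum_nonneg fun i _ => mul_nonneg hρ0 (norm_nonneg _)
        exact mul_nonneg (mul_nonneg zero_le_two hBMC) this
  have hT4 : -(∫ w : ℝ × EuclideanSpace ℝ (Fin 3), Φ w.1 w.2 * (Δ (η w.1)) w.2) ≤ (∫ w : ℝ × EuclideanSpace ℝ (Fin 3), Φ' w * |(Δ (η₀ w.1)) w.2|) +
      (B' * M₀ * C * (∫ w : ℝ × EuclideanSpace ℝ (Fin 3), ∑ i ∈ s, |(Δ (ψ i w.1)) w.2|) +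
       6 * B' * M₁ * C * ∫ w : ℝ × EuclideanSpace ℝ (Fin 3), ∑ i ∈ s, ‖fderiv ℝ (ψ i w.1) w.2‖) := by
    have hgi' : Integrable (fun w : ℝ × EuclideanSpace ℝ (Fin 3) => B' * M₀ * C * ∑ i ∈ s, |(Δ (ψ i w.1)) w.2| +
        6 * B' * M₁ * C * ∑ i ∈ s, ‖fderiv ℝ (ψ i w.1) w.2‖) := (iE₄.const_mul (B' * M₀ * C)).add (iE₅.const_mul (6 * B' * M₁ * C))
    have hgi : Integrable (fun w : ℝ × EuclideanSpace ℝ (Fin 3) => Φ' w * |(Δ (η₀ w.1)) w.2| +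
        (B' * M₀ * C * ∑ i ∈ s, |(Δ (ψ i w.1)) w.2| + 6 * B' * M₁ * C * ∑ i ∈ s, ‖fderiv ℝ (ψ i w.1) w.2‖)) := im₄.add hgi'
    have key := neg_integral_le_integral_of_le
      (f := fun w : ℝ × EuclideanSpace ℝ (Fin 3) => Φ w.1 w.2 * (Δ (η w.1)) w.2) hgi ?_ ?_
    · rw [integral_add im₄ hgi', integral_add (iE₄.const_mul (B' * M₀ * C)) (iE₅.const_mul (6 * B' * M₁ * C)),
        integral_const_mul, integral_const_mul] at key
      exact key
    · filter_upwards [haeS] with w hwS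
      have hs4 : 0 ≤ ∑ i ∈ s, |(Δ (ψ i w.1)) w.2| := Finset.sum_nonneg fun i _ => abs_nonneg _
      have hs5 : 0 ≤ ∑ i ∈ s, ‖fderiv ℝ (ψ i w.1) w.2‖ := Finset.sum_nonneg fun i _ => norm_nonneg _
      by_cases hw : w ∈ K
      · rw [hΦ'K w hw]
        exact add_nonneg (mul_nonneg (hpos w (hKW hw) hwS) (abs_nonneg _))
          (add_nonneg (mul_nonneg hBMC hs4) (mul_nonneg hBM1C hs5))
      · simp only [hΦ', indicator_of_notMem hw, zero_mul, zero_add]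
        exact add_nonneg (mul_nonneg hBMC hs4) (mul_nonneg hBM1C hs5)
    · filter_upwards [haeS] with w hwS
      have hs4' : 0 ≤ ∑ i ∈ s, |(Δ (ψ i w.1)) w.2| := Finset.sum_nonneg fun i _ => abs_nonneg _
      have hs5' : 0 ≤ ∑ i ∈ s, ‖fderiv ℝ (ψ i w.1) w.2‖ := Finset.sum_nonneg fun i _ => norm_nonneg _
      have hs4 : 0 ≤ C * ∑ i ∈ s, |(Δ (ψ i w.1)) w.2| := mul_nonneg hC0 (Finset.sum_nonneg fun i _ => abs_nonneg _)
      have hs5 : 0 ≤ C * ∑ i ∈ s, ‖fderiv ℝ (ψ i w.1) w.2‖ := mul_nonneg hC0 (Finset.sum_nonneg fun i _ => norm_nonneg _)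
      by_cases hw : w ∈ K
      · rw [hΦ'K w hw]
        have hΦ0 := hpos w (hKW hw) hwS
        have h1 : -(Φ w.1 w.2 * (Δ (η w.1)) w.2) ≤ Φ w.1 w.2 * (|(Δ (η₀ w.1)) w.2| +
            η₀ w.1 w.2 * (C * ∑ i ∈ s, |(Δ (ψ i w.1)) w.2|) +
            6 * ‖fderiv ℝ (η₀ w.1) w.2‖ * (C * ∑ i ∈ s, ‖fderiv ℝ (ψ i w.1) w.2‖)) := by
          rw [← mul_neg]; exact mul_le_mul_of_nonneg_left (hdl w.1 w.2) hΦ0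
        have h3 := mul_le_mul_of_nonneg_right (hΦη₀ w hw hwS) hs4
        have h4 : Φ w.1 w.2 * ‖fderiv ℝ (η₀ w.1) w.2‖ ≤ B' * M₁ := mul_le_mul (hΦB w (hKW hw) hwS) (hM₁ w) (norm_nonneg _) hB'0
        have h5 := mul_le_mul_of_nonneg_right h4 hs5
        linear_combination h1 + h3 + 6 * h5
      · rw [(hderivη0 w hw).2.2, hΦ']
        simp only [mul_zero, neg_zero, indicator_of_notMem hw, zero_mul, zero_add]
        exact add_nonneg (mul_nonneg hBMC hs4') (mul_nonneg hBM1C hs5')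
  have h₀ax : Integrable fun q : ℝ × ℝ => η₀ q.1 (meridianPoint (0, q.2)) := integrable_comp_axis (F := uncurry η₀) hη₀.contDiff.continuous hη₀.hasCompactSupport
  have h₁ax : Integrable fun q : ℝ × ℝ => η q.1 (meridianPoint (0, q.2)) := integrable_comp_axis (F := uncurry η) htest.contDiff.continuous htest.hasCompactSupport
  have hax_loss := axis_integral_sub_le s hr hψ hσ hG hg hη hM₀0 hη₀M h₀ax h₁ax
  have i12 : Integrable (fun w : ℝ × EuclideanSpace ℝ (Fin 3) => Φ' w * |deriv (fun τ => η₀ τ w.2) w.1| +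
      Φ' w * (K.indicator (fun w : ℝ × EuclideanSpace ℝ (Fin 3) => ‖U w.1 w.2‖) w * ‖fderiv ℝ (η₀ w.1) w.2‖)) := im₁.add im₂
  have i123 : Integrable (fun w : ℝ × EuclideanSpace ℝ (Fin 3) => Φ' w * |deriv (fun τ => η₀ τ w.2) w.1| +
      Φ' w * (K.indicator (fun w : ℝ × EuclideanSpace ℝ (Fin 3) => ‖U w.1 w.2‖) w * ‖fderiv ℝ (η₀ w.1) w.2‖) +
      Φ' w * (K.indicator (fun w : ℝ × EuclideanSpace ℝ (Fin 3) => (cylRadius w.2)⁻¹) w * (2 * ‖fderiv ℝ (η₀ w.1) w.2‖))) := i12.add im₃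
  have hsplit : (∫ w : ℝ × EuclideanSpace ℝ (Fin 3), Φ w.1 w.2 * (|deriv (fun τ => η₀ τ w.2) w.1| +
      ‖U w.1 w.2‖ * ‖fderiv ℝ (η₀ w.1) w.2‖ + 2 / cylRadius w.2 * ‖fderiv ℝ (η₀ w.1) w.2‖ + |(Δ (η₀ w.1)) w.2|)) =
      (∫ w : ℝ × EuclideanSpace ℝ (Fin 3), Φ' w * |deriv (fun τ => η₀ τ w.2) w.1|) +
      (∫ w : ℝ × EuclideanSpace ℝ (Fin 3), Φ' w *
        (K.indicator (fun w : ℝ × EuclideanSpace ℝ (Fin 3) => ‖U w.1 w.2‖) w * ‖fderiv ℝ (η₀ w.1) w.2‖)) +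
      (∫ w : ℝ × EuclideanSpace ℝ (Fin 3), Φ' w *
        (K.indicator (fun w : ℝ × EuclideanSpace ℝ (Fin 3) => (cylRadius w.2)⁻¹) w * (2 * ‖fderiv ℝ (η₀ w.1) w.2‖))) +
      (∫ w : ℝ × EuclideanSpace ℝ (Fin 3), Φ' w * |(Δ (η₀ w.1)) w.2|) := by
    rw [integral_congr_ae (Eventually.of_forall hmeq), integral_add i123 im₄, integral_add i12 im₃, integral_add im₁ im₂]
  have herr : B' * M₀ * C * (∫ w : ℝ × EuclideanSpace ℝ (Fin 3), ∑ i ∈ s, |deriv (fun τ => ψ i τ w.2) w.1|) +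
      B' * M₀ * C * (∫ w : ℝ × EuclideanSpace ℝ (Fin 3), ∑ i ∈ s,
        K.indicator (fun w : ℝ × EuclideanSpace ℝ (Fin 3) => ‖U w.1 w.2‖) w * ‖fderiv ℝ (ψ i w.1) w.2‖) +
      2 * (B' * M₀ * C) * (∫ w : ℝ × EuclideanSpace ℝ (Fin 3), ∑ i ∈ s, (cylRadius w.2)⁻¹ * ‖fderiv ℝ (ψ i w.1) w.2‖) +
      (B' * M₀ * C * (∫ w : ℝ × EuclideanSpace ℝ (Fin 3), ∑ i ∈ s, |(Δ (ψ i w.1)) w.2|) +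
       6 * B' * M₁ * C * ∫ w : ℝ × EuclideanSpace ℝ (Fin 3), ∑ i ∈ s, ‖fderiv ℝ (ψ i w.1) w.2‖) +
      4 * Real.pi * k * (16 * M₀ * ∑ i ∈ s, r i) ≤ Cerr * ∑ i ∈ s, r i := by
    have h1 := mul_le_mul_of_nonneg_left bE₁ hBMC
    have h2 := mul_le_mul_of_nonneg_left bE₂ hBMC
    have h3 := mul_le_mul_of_nonneg_left bE₃ (mul_nonneg zero_le_two hBMC)
    have h4 := mul_le_mul_of_nonneg_left bE₄ hBMC
    have h5 := mul_le_mul_of_nonneg_left bE₅ hBM1C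
    rw [hCerr]
    linear_combination h1 + h2 + h3 + h4 + h5
  have hfinal : 4 * Real.pi * k * ∫ q : ℝ × ℝ, η₀ q.1 (meridianPoint (0, q.2)) ≤ (∫ w : ℝ × EuclideanSpace ℝ (Fin 3), Φ w.1 w.2 * (|deriv (fun τ => η₀ τ w.2) w.1| +
        ‖U w.1 w.2‖ * ‖fderiv ℝ (η₀ w.1) w.2‖ + 2 / cylRadius w.2 * ‖fderiv ℝ (η₀ w.1) w.2‖ + |(Δ (η₀ w.1)) w.2|)) +
      Cerr * ∑ i ∈ s, r i := by
    have hlhs := mul_le_mul_of_nonneg_left hax_loss hkπ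
    linear_combination hlhs + hmain + hT1 + hT2 + hT3 + hT4 + herr - hsplit
  refine hfinal.trans (add_le_add le_rfl ?_)
  calc Cerr * ∑ i ∈ s, r i ≤ Cerr * δ := mul_le_mul_of_nonneg_left hsum hCerr0
    _ ≤ ε := hCδ

end Summit.NavierStokesRegularity.NavierStokesRegularity.Theorems.AxisymmetricKatoGlobal.EulerScaling

end
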